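import Summits.BirchSwinnertonDyer.BirchSwinnertonDyer.Theorems.ByReductionTypeAtTwoOrdKatoHalfAtTwoIsoRelaxedGenuineDefs
import HarnessLib

/-!
# Route ByReductionTypeAtTwo, crux `OrdKatoHalfAtTwoIso` (stmt-BirchSwinnertonDyer-19573), cell [`ρ̄₂` onto ∧ `0 < Δ`] (PAIR child 24097):
# the RESIDUAL text R∞⁺ («Iw⁺ given Q⁺»: the archimedean kernel of the fine duals has `μ = 0`), Thm I per datum in the kernel
# (relaxed (A₂) ⟺ (A₂) ∧ R∞), Thm H modulo Lim@2 upstairs, and the v16-shaped door R⁺ + Aʳ + Q⁺ + R∞⁺ + print ⇒ the conjunct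

Seat `cruxlead-stmt-BirchSwinnertonDyer-19573-w2` GEN 5 (prover WIDTH under the LEAD lineage `cruxlead-19573`; HOME
`run/shared/lean/pub/bsd-2adic/`; pen RC-417 (2): «keep `stub_conjA_two_posDisc` (Q⁺) as THE research stub; if you take the genuine set,
type the residual as “Iw⁺ given Q⁺” = R∞ per Thm I so Q⁺ is not paid twice»). Sequel of `…RelaxedGenuineDefs` (p705378: R⁺, Aʳ, the doors).
HONEST FRAMING (cell bsd-2adic): BSD is not proved by any of this; neither the crux nor the conjunct nor the PAIR child is proved here. ONE
DEFINITION of an OPEN statement displayed BY NAME (`@[conjecture]`, R-B77; NOT a Literature fact, nothing asserted) + theorems.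

* §1 TEXT R∞⁺ `FineArchimedeanKernelMuZeroOrdPosDisc`: on the cell, for every cyclotomic datum and every compatible restriction
  `r : X₀^{rel ∞} ↠ X₀`, `ℓ₍₂₎(ker r) = 0` (reading: `(Sel₀^{rel ∞}/Sel₀)^∨` has `μ = 0` ⟺ `loc_∞ ≠ 0` on `𝐇¹(T₂W)`, [ASP] 6.9 (iv)).
* §2 `lengthAt_fineRelaxed_eq_zero_iff_ker_and_fine` — Thm I per datum, KERNEL: `ℓ₍₂₎(X₀^{rel ∞}) = 0 ⟺ ℓ₍₂₎(ker r) = 0 ∧ ℓ₍₂₎(X₀) = 0`.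
* §3 `relaxedConjATwoPosDisc_of_conjA_of_fineArchKernel` (Q⁺ + R∞⁺ ⟹ relaxed (A₂) on the cell), `fineArchKernelMuZero_of_relaxedConjATwoPosDisc`
  (converse), `fineArchKernelMuZero_of_lim_upstairs_of_classicalMu` and `fineSelmerConjATwoOrdPosDisc_of_lim_upstairs_of_classicalMu`
  (Thm H: Iw⁺ + Lim@2-upstairs ⟹ R∞⁺ and ⟹ Q⁺, kernel modulo the named fact).
* §4 `ordKatoHalfAtTwoIsoPosDisc_of_relaxedZeta_of_arch_of_conjA_of_fineArchKernel` — **the conjunct BY NAME ⟸ R⁺ (memo) + Aʳ (reserve) +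
  Q⁺ (research stub) + R∞⁺ (residual) + Abbes–Ullmo + Kato 17.4**; `ordKatoFineZetaAtTwoResidue_…` — the PAIR child BY NAME with F1μι⁻.

References: reserve [ASP] Thm 6.9 (i)(ii)(iv); [GreenbergLNM1716] §4 Lemma 4.6; [CoatesSujatha2005] (A); [Lim2017FineSelmer] Thm 3.5, Lemma 3.2;
[Kato2004Asterisque] Thm 17.4, Prop 17.11, §17.13; triage r1-2 GEN 37 Thm I / Prop J, GEN 36 Thm H; pen RC-417; tree p699544, p703881, p704497,
p705378, `…FineRoadRelaxedFine` / `…FineRoadLimRelUpstairs` (bsd-f1-sign2).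
-/

set_option autoImplicit false
set_option linter.dupNamespace false

noncomputable section

open scoped Classical MatrixGroups ModularForm NumberField
open CongruenceSubgroup WeierstrassCurve Field IsDedekindDomain NumberField
open Literature.NumberTheory.GaloisRepresentations
open Literature.NumberTheory.GaloisCohomology
open Literature.NumberTheory.EllipticCurves Literature.NumberTheory.EllipticCurves.ModularForms
open Literature.NumberTheory.EllipticCurves.Kato2004
  Literature.NumberTheory.EllipticCurves.Kato2004.EulerSystemValues
open Literature.NumberTheory.EllipticCurves.Rank1Residual
open Literature.NumberTheory.EllipticCurves.Greenberg1999
open Literature.NumberTheory.IwasawaTheory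
open Summit.BirchSwinnertonDyer.BirchSwinnertonDyer.Theorems.Rank1ResidualX1Defs
  Summit.BirchSwinnertonDyer.BirchSwinnertonDyer.Rank1Residual
  Summit.BirchSwinnertonDyer.BirchSwinnertonDyer.Rank1Residual.CoreAssembly
open Summit.BirchSwinnertonDyer.Rank1Residual Summit.BirchSwinnertonDyer.Rank1Residual.X5
  Summit.BirchSwinnertonDyer.Rank1Residual.X1.MuLambda
open Summit.BirchSwinnertonDyer.BirchSwinnertonDyer.Theorems.OrdKatoOptimalAtTwo
  Summit.BirchSwinnertonDyer.BirchSwinnertonDyer.Theorems.OrdKatoIntAtTwo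
open Summit.BirchSwinnertonDyer.BirchSwinnertonDyer.Theses.ByReductionTypeAtTwo
open Summit.BirchSwinnertonDyer.BirchSwinnertonDyer.Theorems.AlignedTransportAtTwoFineRoad

namespace Summit.BirchSwinnertonDyer.BirchSwinnertonDyer.Theorems.SteinbergFibreAtTwo

/-! ## §1 R∞⁺ — the residual «Iw⁺ given Q⁺» on the cell (DISPLAYED TEXT) -/

/-- [RESEARCH residual, OPEN — nothing asserted] **R∞⁺ — the archimedean kernel of the FINE duals has `μ = 0` on the cell
[`ρ̄₂` onto ∧ `0 < Δ`]** (pen RC-417 (2): «type the residual as “Iw⁺ given Q⁺” = R∞ per Thm I, so Q⁺ is not paid twice»). For every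
globally minimal, non-CM, analytic-rank-`0`, good-ordinary-at-`2` `W/ℚ` with `ρ̄_{W,2}` onto and `0 < Δ_W`, every cyclotomic `κ` with
topological generator `γ`, every fine Selmer dual datum `Y` (`X₀`, STRICT at `∞`), relaxed fine datum `Yr` (`X₀^{rel ∞}`) and every
`Λ`-linear `r : X₀^{rel ∞} → X₀` compatible with the dualities (the restriction of characters along `Sel₀ ≤ Sel₀^{rel ∞}`; exists, unique,
onto — cell bsd-f1-sign2 `RelaxedRestrict.exists_relaxedRestrict`): `ℓ₍₂₎(ker r) = 0`, i.e. `μ((Sel₀^{rel ∞}/Sel₀)^∨) = 0`. READING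
([ASP] Thm 6.9 (iv), reserve): `0 → 𝐇¹_∞(T) → 𝐇¹(T) → H¹(ℝ, T)⟦Γ⟧ = Λ/2 → (Sel₀^{rel ∞}/Sel₀)^∨ → 0`, so R∞⁺ ⟺ «`loc_∞ ≠ 0` on
`𝐇¹(T₂W)`» (alternative (A): Kato's classes are `2`-divisible in `𝐇¹`) — the symptom R∞ of triage r1-2. Thm I (triage-2 GEN 37):
Iw⁺ ⟺ relaxed (A₂) ⟺ Q⁺ ∧ R∞⁺ (the last «⟺» is kernel, §2). NOT known necessary for the conjunct; NOT a Literature fact; nothing asserted.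
[cite: GreenbergLNM1716, §4 Lemma 4.6 (PDF pp. 106–107) (shape only; nothing asserted)] [cite: CoatesSujatha2005, statement (A) (§3) (shape)] -/
@[conjecture] def FineArchimedeanKernelMuZeroOrdPosDisc : Prop :=
  ∀ (W : WeierstrassCurve ℚ) [W.IsElliptic] [W.IsGloballyMinimal], ¬ W.HasCM → W.analyticRank = 0 →
    GoodOrd W 2 → W.HasSurjectiveModNGaloisRep 2 → 0 < W.Δ →
    ∀ (κ : ZpExtension ℚ 2) (γ : absoluteGaloisGroup ℚ), κ.IsCyclotomic → κ.IsTopGenerator γ →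
    ∀ (Y : W.FineSelmerDualData κ γ) (Yr : W.FineSelmerDualDataRelaxedInf κ γ) (r : Yr.X →ₗ[IwasawaAlgebra 2] Y.X),
      (∀ (x : Yr.X) (s : W.fineSelmerInfty κ),
        Y.toDual (r x) s = Yr.toDual x (AddSubgroup.inclusion (W.fineSelmerInfty_le_fineSelmerInftyRelaxedInf κ) s)) →
      Module.lengthAt (IwasawaAlgebra 2) (LinearMap.ker r) ⟨IwasawaAlgebra.augIdealP 2, IwasawaAlgebra.isPrime_augIdealP_holds 2⟩ = 0

/-- `FineArchimedeanKernelMuZeroOrdPosDisc` unfolds to its displayed body. [folklore] -/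
theorem fineArchimedeanKernelMuZeroOrdPosDisc_iff : FineArchimedeanKernelMuZeroOrdPosDisc ↔
    ∀ (W : WeierstrassCurve ℚ) [W.IsElliptic] [W.IsGloballyMinimal], ¬ W.HasCM → W.analyticRank = 0 →
    GoodOrd W 2 → W.HasSurjectiveModNGaloisRep 2 → 0 < W.Δ →
    ∀ (κ : ZpExtension ℚ 2) (γ : absoluteGaloisGroup ℚ), κ.IsCyclotomic → κ.IsTopGenerator γ →
    ∀ (Y : W.FineSelmerDualData κ γ) (Yr : W.FineSelmerDualDataRelaxedInf κ γ) (r : Yr.X →ₗ[IwasawaAlgebra 2] Y.X),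
      (∀ (x : Yr.X) (s : W.fineSelmerInfty κ),
        Y.toDual (r x) s = Yr.toDual x (AddSubgroup.inclusion (W.fineSelmerInfty_le_fineSelmerInftyRelaxedInf κ) s)) →
      Module.lengthAt (IwasawaAlgebra 2) (LinearMap.ker r) ⟨IwasawaAlgebra.augIdealP 2, IwasawaAlgebra.isPrime_augIdealP_holds 2⟩ = 0 :=
  Iff.rfl

/-! ## §2 Thm I per datum (KERNEL): relaxed (A₂) ⟺ (A₂) ∧ R∞ -/

section PerDatum

variable {W : WeierstrassCurve ℚ} {κ : ZpExtension ℚ 2} {γ : absoluteGaloisGroup ℚ}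

/-- **Thm I per datum (kernel; triage r1-2 GEN 37)**: for the restriction `r : X₀^{rel ∞} ↠ X₀` compatible with the dualities,
`ℓ₍₂₎(X₀^{rel ∞}) = 0 ⟺ ℓ₍₂₎(ker r) = 0 ∧ ℓ₍₂₎(X₀) = 0` — additivity of local length on `0 → ker r → X₀^{rel ∞} → X₀ → 0` (`r` onto by
the injectivity of `ℚ/ℤ`). So «relaxed (A₂)» = «(A₂) ∧ R∞» datum by datum. [cite: GreenbergLNM1716, §4 Lemma 4.6] [cite: Washington1997, §13.2] -/
theorem lengthAt_fineRelaxed_eq_zero_iff_ker_and_fine (Y : W.FineSelmerDualData κ γ) (Yr : W.FineSelmerDualDataRelaxedInf κ γ)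
    (r : Yr.X →ₗ[IwasawaAlgebra 2] Y.X)
    (hr : ∀ (x : Yr.X) (s : W.fineSelmerInfty κ),
      Y.toDual (r x) s = Yr.toDual x (AddSubgroup.inclusion (W.fineSelmerInfty_le_fineSelmerInftyRelaxedInf κ) s)) :
    Module.lengthAt (IwasawaAlgebra 2) Yr.X ⟨IwasawaAlgebra.augIdealP 2, IwasawaAlgebra.isPrime_augIdealP_holds 2⟩ = 0 ↔
      Module.lengthAt (IwasawaAlgebra 2) (LinearMap.ker r) ⟨IwasawaAlgebra.augIdealP 2, IwasawaAlgebra.isPrime_augIdealP_holds 2⟩ = 0 ∧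
      Module.lengthAt (IwasawaAlgebra 2) Y.X ⟨IwasawaAlgebra.augIdealP 2, IwasawaAlgebra.isPrime_augIdealP_holds 2⟩ = 0 := by
  rw [RelaxedRestrict.lengthAt_eq_lengthAt_ker_relaxedRestrict_add W κ Yr Y r hr, add_eq_zero]

end PerDatum

/-! ## §3 Q⁺ + R∞⁺ ⟹ relaxed (A₂) on the cell, and back; Iw⁺ ⟹ Q⁺ ∧ R∞⁺ (Thm H / Thm I in the kernel modulo Lim@2 upstairs) -/

/-- **Q⁺ + R∞⁺ ⟹ RELAXED (A₂) on the cell** (the `∀`-form consumed by `ordKatoHalfAtTwoIsoPosDisc_of_relaxedColeman_of_relaxedConjA`):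
Q⁺ gives «`Sel₀(W/ℚ_∞)[2]` finite» for every cyclotomic `κ` (`finite_fineSelmerInfty_twoTorsion_of_conjA_two`), hence `ℓ₍₂₎(X₀) = 0` for
the constructed strict datum w.r.t. `γ`; R∞⁺ kills the archimedean kernel of the restriction `X₀^{rel ∞} ↠ X₀`; additivity (§2).
[cite: CoatesSujatha2005, statement (A) (§3)] [cite: GreenbergLNM1716, §1 p. 60 and §4 Lemma 4.6] -/
theorem relaxedConjATwoPosDisc_of_conjA_of_fineArchKernel (hQ : FineSelmerConjATwoOrdPosDisc)
    (hRinf : FineArchimedeanKernelMuZeroOrdPosDisc) :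
    ∀ (W : WeierstrassCurve ℚ) [W.IsElliptic] [W.IsGloballyMinimal], ¬ W.HasCM → W.analyticRank = 0 →
      GoodOrd W 2 → W.HasSurjectiveModNGaloisRep 2 → 0 < W.Δ →
      ∀ (κ : ZpExtension ℚ 2) (γ : absoluteGaloisGroup ℚ), κ.IsCyclotomic → κ.IsTopGenerator γ →
      ∀ Yr : W.FineSelmerDualDataRelaxedInf κ γ,
        Module.lengthAt (IwasawaAlgebra 2) Yr.X ⟨IwasawaAlgebra.augIdealP 2, IwasawaAlgebra.isPrime_augIdealP_holds 2⟩ = 0 := by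
  intro W _ _ hcm hr hgo h2 hΔ κ γ hκ hγ Yr
  let Y : W.FineSelmerDualData κ γ := W.fineSelmerDualData κ hγ
  obtain ⟨r, hrY⟩ := RelaxedRestrict.exists_relaxedRestrict W κ hγ Yr Y
  rw [lengthAt_fineRelaxed_eq_zero_iff_ker_and_fine Y Yr r hrY]
  exact ⟨hRinf W hcm hr hgo h2 hΔ κ γ hκ hγ Y Yr r hrY,
    AlignedTransportAtTwoFineRoad.lengthAt_fineSelmerDual_eq_zero_of_finite_twoTorsion W hγ Y
      (finite_fineSelmerInfty_twoTorsion_of_conjA_two W (hQ W hcm hr hgo h2 hΔ) κ hκ)⟩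

/-- **Conversely, RELAXED (A₂) on the cell ⟹ R∞⁺** (additivity, §2: a summand of a length-`0` module has length `0`). Together with
relaxed (A₂) ⟹ (A₂) (`finite_pTorsion_fineSelmer_of_relaxed`, tree) this is Thm I's «relaxed (A₂) ⟺ Q⁺ ∧ R∞» on the cell, kernel.
[cite: GreenbergLNM1716, §4 Lemma 4.6] -/
theorem fineArchKernelMuZero_of_relaxedConjATwoPosDisc
    (hAr : ∀ (W : WeierstrassCurve ℚ) [W.IsElliptic] [W.IsGloballyMinimal], ¬ W.HasCM → W.analyticRank = 0 →
      GoodOrd W 2 → W.HasSurjectiveModNGaloisRep 2 → 0 < W.Δ →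
      ∀ (κ : ZpExtension ℚ 2) (γ : absoluteGaloisGroup ℚ), κ.IsCyclotomic → κ.IsTopGenerator γ →
      ∀ Yr : W.FineSelmerDualDataRelaxedInf κ γ,
        Module.lengthAt (IwasawaAlgebra 2) Yr.X ⟨IwasawaAlgebra.augIdealP 2, IwasawaAlgebra.isPrime_augIdealP_holds 2⟩ = 0) :
    FineArchimedeanKernelMuZeroOrdPosDisc := by
  intro W _ _ hcm hr hgo h2 hΔ κ γ hκ hγ Y Yr r hrY
  exact ((lengthAt_fineRelaxed_eq_zero_iff_ker_and_fine Y Yr r hrY).mp (hAr W hcm hr hgo h2 hΔ κ γ hκ hγ Yr)).1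

/-- **Thm H, R∞ half (kernel modulo the named fact): Iw⁺ + Lim 2017 Thm 3.5 at `2` UPSTAIRS ⟹ R∞⁺** — via relaxed (A₂)
(`relaxedConjATwoPosDisc_of_lim_upstairs_of_classicalMu`, p704497) and §2. [cite: Lim2017FineSelmer, §3 Thm. 3.5 and Lemma 3.2]
[cite: Iwasawa1973MuInvariants, §1 (shape)] -/
theorem fineArchKernelMuZero_of_lim_upstairs_of_classicalMu
    (hLim : Lim2017.thm35_at_two_upstairs_fineSelmer_twoTorsion_finite_of_classicalMuVanishes)
    (hIw : ClassicalMuTwoDivisionFieldAdjoinIOrdPosDisc) : FineArchimedeanKernelMuZeroOrdPosDisc :=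
  fineArchKernelMuZero_of_relaxedConjATwoPosDisc (relaxedConjATwoPosDisc_of_lim_upstairs_of_classicalMu hLim hIw)

/-- **Thm H, Q⁺ half (kernel modulo the named fact): Iw⁺ + Lim 2017 Thm 3.5 at `2` UPSTAIRS ⟹ Q⁺** (statement (A) downstairs in the
route's `∃ γ D` currency, cell bsd-f1-sign2 `exists_fineSelmerDualData_moduleFinite_of_lim2017`; `i` = a square root of `−1` in `ℚ̄`).
Compare the lead's `fineSelmerConjATwoOrdPosDisc_of_lim_of_classicalMu` (through the older downstairs Lim fact).
[cite: Lim2017FineSelmer, §3 Thm. 3.5 and Lemma 3.2] [cite: CoatesSujatha2005, statement (A) (§3)] -/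
theorem fineSelmerConjATwoOrdPosDisc_of_lim_upstairs_of_classicalMu
    (hLim : Lim2017.thm35_at_two_upstairs_fineSelmer_twoTorsion_finite_of_classicalMuVanishes)
    (hIw : ClassicalMuTwoDivisionFieldAdjoinIOrdPosDisc) : FineSelmerConjATwoOrdPosDisc := by
  intro W _ _ hcm hr hgo h2 hΔ κ hκ
  obtain ⟨i, hi⟩ : ∃ i : AlgebraicClosure ℚ, i ^ 2 = -1 := by
    obtain ⟨i, hi⟩ := IsAlgClosed.exists_pow_nat_eq (-1 : AlgebraicClosure ℚ) (n := 2) (by norm_num)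
    exact ⟨i, hi⟩
  exact LimRelUpstairs.exists_fineSelmerDualData_moduleFinite_of_lim2017 W κ hLim i hi (hIw W hcm hr hgo h2 hΔ i hi) hκ

/-! ## §4 The v16-shaped door: R⁺ (memo) + Aʳ (reserve) + Q⁺ (THE research stub) + R∞⁺ (residual) + print ⇒ the conjunct -/

/-- **The `0 < Δ` conjunct `OrdKatoHalfAtTwoIsoPosDisc` BY NAME from R⁺, Aʳ, Q⁺, R∞⁺, Abbes–Ullmo and Kato 17.4 (1)(2) at `2`** — the
stub set the pen prefers for a genuine-currency v16 (RC-417 (2)): Q⁺ stays THE research stub (kernel-necessary, p703881), R∞⁺ is the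
residual «Iw⁺ given Q⁺», R⁺/Aʳ the memo/reserve Coleman inputs with NO half class. CONDITIONAL; nothing closed.
[cite: Kato2004Asterisque, Thm. 17.4 (1)(2) (p. 273), Prop. 17.11, §17.13] [cite: AbbesUllmo1996, Thm. A] [cite: CoatesSujatha2005, Conj. A (shape)] -/
theorem ordKatoHalfAtTwoIsoPosDisc_of_relaxedZeta_of_arch_of_conjA_of_fineArchKernel (hR : RelaxedZetaColemanIotaPosDiscAtTwo)
    (hA : ArchimedeanLambdaModTwoOrdAtTwo) (hQ : FineSelmerConjATwoOrdPosDisc) (hRinf : FineArchimedeanKernelMuZeroOrdPosDisc)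
    (hAU : abbesUllmo_not_dvd_maninConstant_of_not_dvd_level)
    (h17 : ∀ (V : WeierstrassCurve ℚ) [V.IsElliptic] [V.IsGloballyMinimal] [NeZero (V.conductorNorm ℤ)]
      (f : CuspForm (Gamma0 (V.conductorNorm ℤ)) 2), kato_divisibility_allPrimes V 2 (f := f)) :
    OrdKatoHalfAtTwoIsoPosDisc :=
  ordKatoHalfAtTwoIsoPosDisc_of_relaxedZeta_of_arch_of_relaxedConjA hR hA
    (relaxedConjATwoPosDisc_of_conjA_of_fineArchKernel hQ hRinf) hAU h17

/-- **The PAIR child `OrdKatoFineZetaAtTwoResidue` (stmt-BirchSwinnertonDyer-24097) BY NAME in the v16-shaped genuine currency**: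
F1μι⁻ + R⁺ + Aʳ + Q⁺ + R∞⁺ + Abbes–Ullmo + Kato 17.4 (1)(2). CONDITIONAL; nothing closed. [cite: Kato2004Asterisque, Thm. 12.6, 16.6, 17.4, Prop. 17.11, §17.13 (shape)] -/
theorem ordKatoFineZetaAtTwoResidue_of_negDisc_of_relaxedZeta_of_arch_of_conjA_of_fineArchKernel (hNeg : ZetaColemanMuIotaNegDiscAtTwo)
    (hR : RelaxedZetaColemanIotaPosDiscAtTwo) (hA : ArchimedeanLambdaModTwoOrdAtTwo) (hQ : FineSelmerConjATwoOrdPosDisc)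
    (hRinf : FineArchimedeanKernelMuZeroOrdPosDisc) (hAU : abbesUllmo_not_dvd_maninConstant_of_not_dvd_level)
    (h17 : ∀ (V : WeierstrassCurve ℚ) [V.IsElliptic] [V.IsGloballyMinimal] [NeZero (V.conductorNorm ℤ)]
      (f : CuspForm (Gamma0 (V.conductorNorm ℤ)) 2), kato_divisibility_allPrimes V 2 (f := f)) :
    OrdKatoFineZetaAtTwoResidue :=
  ordKatoFineZetaAtTwoResidue_of_halves hNeg
    (ordKatoHalfAtTwoIsoPosDisc_of_relaxedZeta_of_arch_of_conjA_of_fineArchKernel hR hA hQ hRinf hAU h17)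

end Summit.BirchSwinnertonDyer.BirchSwinnertonDyer.Theorems.SteinbergFibreAtTwo

end
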